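import Literature.AlgebraicGeometry.ComplexMultiplication.ShimuraInflation
import Literature.AlgebraicGeometry.HodgeTheory.AbelianVarietyEndomorphismsHOne
import Literature.NumberTheory.DiophantineGeometry.AVKernelHopf
import Mathlib.CategoryTheory.Preadditive.Biproducts
import HarnessLib

/-!
# The two Betti junction hypotheses of type inflation are theorems (kernel; no torus dictionary)

Companion of `ShimuraInflation` / `ShimuraIsogeny`.  Those files assemble the `H¹`-form of Shimura's type inflation
`Shimura1998_Thm3_inflation` in the kernel (`thm3_inflation_of`) from two printed records and two statements they
classify as NAMED OPEN JUNCTION HYPOTHESES of the model-construction cell (boundary referee ref1-g4, entry 116),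
used there only as explicit binders `(hb : isogeny_bettiMap_bijective)` and `(hc : product_bettiMap_bijective)`
and earmarked «to be discharged in the kernel once the tree has `A(ℂ) ≅ V/Λ` and Künneth in degree one».
This file DISCHARGES BOTH, with no new record and without the torus dictionary: neither statement needs
`A(ℂ) ≅ V/Λ`; both follow from the ADDITIVITY of `f ↦ f^*` on `H¹(A(ℂ); ℚ)` for homomorphisms of complex abelian
varieties, which the tree proves by the Eckmann–Hilton argument (`HodgeTheory.mapContinuous_add_hom`: `(f + g)(ℂ)`
is the pointwise product of `f(ℂ)` and `g(ℂ)` in the topological group `A(ℂ)`; `HodgeTheory.singularCohomology.map_mul_one_of_field`: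
a pointwise product acts on `H¹(−; F)` as the sum, `F` a field — `AbelianVarietyEndomorphismsHOne`, there applied
with `F = ℂ`, here with `F = ℚ`).

* `bettiCohomology_map_add_one` / `_zero_one` / `_nsmul_one` / `_sum_one` / `_nsmul_id_one`: `(f + g)^* = f^* + g^*`,
  `0^* = 0`, `(n • f)^* = n • f^*`, `(∑ fᵢ)^* = ∑ fᵢ^*`, `[n]_A^* = n` on `H¹(−(ℂ); ℚ)` (kernel).
* `isogeny_bettiMap_bijective_holds : isogeny_bettiMap_bijective` (kernel).  An isogeny `g : A → A′` has a
  quasi-inverse `g′` with `g′ ∘ g = [n]_A`, `g ∘ g′ = [n]_{A′}`, `n ≥ 1` — a THEOREM of the tree,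
  `Motives.AbelianVariety.IsIsogeny.exists_nsmul_inverse_holds` (`NumberTheory/DiophantineGeometry/AVKernelHopf`:
  the kernel of an isogeny is killed by its order, Deligne's theorem on finite commutative group schemes, and
  `[n]_A` descends to the fpqc quotient `A / Ker g = A′`; the printed statement is Mumford, *Abelian Varieties*, §19,
  Remark p. 169 = Görtz–Wedhorn II, Prop. 27.190, and, one-sided, Milne 1986, *Abelian Varieties* (in
  Cornell–Silverman), §8 ¶1, held chunk p0181 L3 «Let n = deg(f); then ker(f) ⊂ ker(n_A) and so n_A factors as
  n_A = g ∘ f with g an isogeny B → A.»).  On `H¹(−; ℚ)` this gives `g^* ∘ g′^* = n = g′^* ∘ g^*` with `n`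
  invertible in `ℚ`, so `g^*` is bijective.  (The printed sentence the junction joined — Birkenhake–Lange 1992,
  Prop. 1.1.13 (a), quoted in `ShimuraIsogeny` — is thereby not needed as an input.)
* `product_bettiMap_bijective_holds : product_bettiMap_bijective` (kernel).  `AbelianVariety ℂ` is preadditive
  (the tree's instance, `Motives.AbelianVariety`), so a product fan `(π_j : P → B)_{j < h}` is a biproduct: Mathlib's
  `Bicone.ofLimitCone` / `biconeIsBilimitOfLimitConeOfIsLimit` supply coprojections `ι_j : B → P` with
  `ι_i ≫ π_j = δ_{ij}` and `∑_j π_j ≫ ι_j = 𝟙_P` (`IsBilimit.total`).  Applying the additive functor `H¹(−(ℂ); ℚ)`: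
  `π_j^* ≫ ι_i^* = δ_{ij}` and `∑_j ι_j^* ≫ π_j^* = 𝟙`, whence `v ↦ ∑_j π_j^* v_j` is bijective with inverse
  `w ↦ (ι_j^* w)_j` (`bijective_sum_comp_proj`, plain linear algebra).  (The printed sentences the junction joined —
  Birkenhake–Lange 1992 §1.1 p0021 L5 and Lemma 1.1.17 (a), quoted in `ShimuraInflation` — are not needed as inputs.)
* `thm3_inflation_of_printed : Shimura1998_Thm3_isogenousPower → Shimura1998_Thm2_Cor → Shimura1998_Thm3_inflation` —
  `thm3_inflation_of` with its two junction binders discharged: type inflation on `H¹` now rests on the printed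
  Corollary `Shimura1998_Thm2_Cor` and the one remaining open junction hypothesis `Shimura1998_Thm3_isogenousPower`.

No `def … : Prop`, no record, no new cited input; `#print axioms` of every theorem = `[propext, Classical.choice,
Quot.sound]`.  The bytes of `ShimuraInflation` / `ShimuraIsogeny` are untouched (their docstrings still say
«open junction hypothesis»; the discharge is by name, here).
-/

noncomputable section

open CategoryTheory Limits

namespace Literature.AlgebraicGeometry.ComplexMultiplication

open Literature.AlgebraicGeometry.Motives (SchemeOver AbelianVariety bettiCohomology AlgPoints)
open Literature.AlgebraicTopology.SingularHomology
open Literature.AlgebraicGeometry.HodgeTheory (mapContinuous_add_hom)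

/-! ### Homomorphisms of complex abelian varieties act additively on `H¹(−(ℂ); ℚ)` -/

section Additive

variable {A B C : AbelianVariety ℂ}

/-- `(f + g)^* = f^* + g^*` on `H¹(B(ℂ); ℚ) → H¹(A(ℂ); ℚ)` (Eckmann–Hilton, as the tree's `complexBetti_map_add_one`
with `ℚ` for `ℂ`). [folklore] -/
theorem bettiCohomology_map_add_one (f g : A ⟶ B) :
    bettiCohomology.map (f + g).hom.hom.hom 1 =
      bettiCohomology.map f.hom.hom.hom 1 + bettiCohomology.map g.hom.hom.hom 1 := by
  change singularCohomology.map ℚ ℚ (AlgPoints.mapContinuous (L := ℂ) (f + g).hom.hom.hom) 1 = _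
  rw [mapContinuous_add_hom, HodgeTheory.singularCohomology.map_mul_one_of_field]

/-- `0^* = 0` on `H¹(−; ℚ)`. [folklore] -/
theorem bettiCohomology_map_zero_one : bettiCohomology.map (0 : A ⟶ B).hom.hom.hom 1 = 0 := by
  have h := bettiCohomology_map_add_one (0 : A ⟶ B) 0
  rw [add_zero] at h
  exact add_eq_left.1 h.symm

/-- `(n • f)^* = n • f^*` on `H¹(−; ℚ)`. [folklore] -/
theorem bettiCohomology_map_nsmul_one (n : ℕ) (f : A ⟶ B) :
    bettiCohomology.map (n • f).hom.hom.hom 1 = n • bettiCohomology.map f.hom.hom.hom 1 := by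
  induction n with
  | zero => rw [zero_smul, zero_smul, bettiCohomology_map_zero_one]
  | succ n ih => rw [add_smul, one_smul, bettiCohomology_map_add_one, ih, add_smul, one_smul]

/-- `(∑ fᵢ)^* = ∑ fᵢ^*` on `H¹(−; ℚ)`. [folklore] -/
theorem bettiCohomology_map_sum_one {ι : Type*} (s : Finset ι) (f : ι → (A ⟶ B)) :
    bettiCohomology.map (∑ i ∈ s, f i).hom.hom.hom 1 = ∑ i ∈ s, bettiCohomology.map (f i).hom.hom.hom 1 := by
  classical
  induction s using Finset.induction_on with
  | empty => rw [Finset.sum_empty, Finset.sum_empty, bettiCohomology_map_zero_one]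
  | insert i s hi ih => rw [Finset.sum_insert hi, Finset.sum_insert hi, bettiCohomology_map_add_one, ih]

/-- `(𝟙 A)^* = 𝟙`. [folklore] -/
theorem bettiCohomology_map_id_hom (k : ℕ) : bettiCohomology.map (𝟙 A : A ⟶ A).hom.hom.hom k = 𝟙 _ := by
  change bettiCohomology.map (𝟙 A.X) k = _
  exact bettiCohomology.map_id k

/-- `(f ≫ g)^* = g^* ≫ f^*`. [folklore] -/
theorem bettiCohomology_map_comp_hom (f : A ⟶ B) (g : B ⟶ C) (k : ℕ) :
    bettiCohomology.map (f ≫ g).hom.hom.hom k =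
      bettiCohomology.map g.hom.hom.hom k ≫ bettiCohomology.map f.hom.hom.hom k := by
  change bettiCohomology.map (f.hom.hom.hom ≫ g.hom.hom.hom) k = _
  exact bettiCohomology.map_comp _ _ k

/-- `[n]^* = n` on `H¹(A(ℂ); ℚ)`. [folklore] -/
theorem bettiCohomology_map_nsmul_id_one (n : ℕ) :
    bettiCohomology.map (n • 𝟙 A : A ⟶ A).hom.hom.hom 1 = n • 𝟙 _ := by
  rw [bettiCohomology_map_nsmul_one, bettiCohomology_map_id_hom]

end Additive

/-! ### Isogenies are bijective on `H¹(−; ℚ)` -/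

/-- If `G ∘ G′ = n • id` on `ℚ`-modules with `n ≠ 0`, then `G′` is injective. [folklore] -/
theorem injective_of_comp_eq_nsmul_id {V W : Type*} [AddCommGroup V] [Module ℚ V] [AddCommGroup W]
    [Module ℚ W] {G' : V →ₗ[ℚ] W} {G : W →ₗ[ℚ] V} {n : ℕ} (hn : 0 < n)
    (h : G ∘ₗ G' = n • LinearMap.id) : Function.Injective G' := by
  intro x y hxy
  have hx := congrArg G hxy
  have e : ∀ z : V, G (G' z) = (n : ℚ) • z := fun z ↦ by
    have := LinearMap.congr_fun h z
    simpa [Nat.cast_smul_eq_nsmul] using this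
  rw [e, e] at hx
  exact smul_right_injective V (by exact_mod_cast hn.ne') hx

/-- If `G ∘ G′ = n • id` on `ℚ`-modules with `n ≠ 0`, then `G` is surjective. [folklore] -/
theorem surjective_of_comp_eq_nsmul_id {V W : Type*} [AddCommGroup V] [Module ℚ V] [AddCommGroup W]
    [Module ℚ W] {G' : V →ₗ[ℚ] W} {G : W →ₗ[ℚ] V} {n : ℕ} (hn : 0 < n)
    (h : G ∘ₗ G' = n • LinearMap.id) : Function.Surjective G := by
  intro z
  refine ⟨G' ((n : ℚ)⁻¹ • z), ?_⟩
  have := LinearMap.congr_fun h ((n : ℚ)⁻¹ • z)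
  simp only [LinearMap.coe_comp, Function.comp_apply, LinearMap.smul_apply, LinearMap.id_coe, id_eq] at this
  rw [this, ← Nat.cast_smul_eq_nsmul ℚ, smul_smul, mul_inv_cancel₀ (by exact_mod_cast hn.ne'), one_smul]

open Literature.AlgebraicGeometry.Motives.AbelianVariety in
/-- **KERNEL: an isogeny of complex abelian varieties is bijective on `H¹(−(ℂ); ℚ)`** — discharges the named open
junction hypothesis `isogeny_bettiMap_bijective` of `ShimuraIsogeny`.  Proof: the tree theorem
`IsIsogeny.exists_nsmul_inverse_holds` (`AVKernelHopf`) gives `g′ : A′ → A` and `n ≥ 1` with `g ≫ g′ = n • 𝟙 A`,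
`g′ ≫ g = n • 𝟙 A′`; by additivity of `f ↦ f^*` on `H¹(−; ℚ)`, `g^* ∘ g′^* = n • id = g′^* ∘ g^*`, and `n` is
invertible in `ℚ`.  (Printed statement of the quasi-inverse: Mumford, *Abelian Varieties* §19 Remark p. 169;
Görtz–Wedhorn II Prop. 27.190; Milne 1986 §8 ¶1, held chunk p0181 L3.) [folklore] -/
theorem isogeny_bettiMap_bijective_holds : isogeny_bettiMap_bijective := by
  intro A A' g hg
  obtain ⟨g', n, hn, h1, h2⟩ := IsIsogeny.exists_nsmul_inverse_holds hg
  -- `h1 : g ≫ g' = n • 𝟙 A`, `h2 : g' ≫ g = n • 𝟙 A'`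
  have e1 : (bettiCohomology.map g.hom.hom.hom 1).hom ∘ₗ (bettiCohomology.map g'.hom.hom.hom 1).hom =
      n • LinearMap.id := by
    rw [← ModuleCat.hom_comp, ← bettiCohomology_map_comp_hom, h1, bettiCohomology_map_nsmul_id_one]
    rfl
  have e2 : (bettiCohomology.map g'.hom.hom.hom 1).hom ∘ₗ (bettiCohomology.map g.hom.hom.hom 1).hom =
      n • LinearMap.id := by
    rw [← ModuleCat.hom_comp, ← bettiCohomology_map_comp_hom, h2, bettiCohomology_map_nsmul_id_one]
    rfl
  exact ⟨injective_of_comp_eq_nsmul_id hn e2, surjective_of_comp_eq_nsmul_id hn e1⟩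

/-! ### `H¹` of a product is the sum of the `H¹` of the factors -/

/-- Linear algebra of a biproduct: families `f_j : V → W`, `g_i : W → V` with `g_i ∘ f_j = δ_{ij}`
and `∑_j f_j ∘ g_j = id` make `v ↦ ∑_j f_j (v_j) : V^ι → W` bijective. [folklore] -/
theorem bijective_sum_comp_proj {R ι V W : Type*} [Semiring R] [Fintype ι] [DecidableEq ι]
    [AddCommMonoid V] [Module R V] [AddCommMonoid W] [Module R W]
    (f : ι → (V →ₗ[R] W)) (g : ι → (W →ₗ[R] V))
    (hgf : ∀ (i j : ι) (x : V), g i (f j x) = if i = j then x else 0)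
    (hfg : ∀ w : W, ∑ j, f j (g j w) = w) :
    Function.Bijective (∑ j, f j ∘ₗ LinearMap.proj j : (ι → V) →ₗ[R] W) := by
  have happ : ∀ v : ι → V, (∑ j, f j ∘ₗ LinearMap.proj j : (ι → V) →ₗ[R] W) v = ∑ j, f j (v j) :=
    fun v ↦ by rw [LinearMap.sum_apply]; rfl
  refine ⟨fun v v' hvv' ↦ ?_, fun w ↦ ⟨fun j ↦ g j w, by rw [happ, hfg]⟩⟩
  funext i
  have e := congrArg (g i) hvv'
  rw [happ, happ, map_sum, map_sum] at e
  simp_rw [hgf] at e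
  simpa [Finset.sum_ite_eq] using e

/-- **KERNEL: `H¹` of a product is the sum of the `H¹` of the factors** — discharges the named open junction
hypothesis `product_bettiMap_bijective` of `ShimuraInflation`: for a product fan `(π_j : P → B)_{j < h}` in
`AbelianVariety ℂ`, `v ↦ ∑_j π_j^* v_j : H¹(B(ℂ); ℚ)^h → H¹(P(ℂ); ℚ)` is bijective.  Proof: `AbelianVariety ℂ` is
preadditive, so the limit fan is a biproduct bicone (`Bicone.ofLimitCone`, `biconeIsBilimitOfLimitConeOfIsLimit`):
coprojections `ι_j` with `ι_i ≫ π_j = δ_{ij}`, `∑_j π_j ≫ ι_j = 𝟙 P` (`IsBilimit.total`); apply the additive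
contravariant functor `H¹(−(ℂ); ℚ)` and `bijective_sum_comp_proj`. [folklore] -/
theorem product_bettiMap_bijective_holds : product_bettiMap_bijective := by
  intro h P B π hlim
  obtain ⟨hl⟩ := hlim
  classical
  -- the product cone is a biproduct bicone (preadditive category): coprojections `ι j : B ⟶ P`
  let 𝔅 : Bicone (fun _ : Fin h ↦ B) := Bicone.ofLimitCone hl
  have h𝔅 : 𝔅.IsBilimit := biconeIsBilimitOfLimitConeOfIsLimit hl
  let ι : Fin h → (B ⟶ P) := fun i ↦ 𝔅.ι i
  have total : ∑ j : Fin h, π j ≫ ι j = 𝟙 P := Limits.IsBilimit.total h𝔅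
  have ιπ : ∀ i j : Fin h, ι i ≫ π j = if i = j then 𝟙 B else 0 := fun i j ↦ by
    have e := 𝔅.ι_π i j
    by_cases hij : i = j
    · subst hij
      rw [dif_pos rfl, eqToHom_refl] at e
      rw [if_pos rfl]
      exact e
    · rw [dif_neg hij] at e
      rw [if_neg hij]
      exact e
  -- on `H¹(−; ℚ)`
  have hιπ : ∀ i j : Fin h,
      bettiCohomology.map (π j).hom.hom.hom 1 ≫ bettiCohomology.map (ι i).hom.hom.hom 1 =
        if i = j then 𝟙 _ else 0 := fun i j ↦ by
    rw [← bettiCohomology_map_comp_hom, ιπ]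
    split_ifs
    · exact bettiCohomology_map_id_hom 1
    · exact bettiCohomology_map_zero_one
  have hπι : ∑ j : Fin h,
      bettiCohomology.map (ι j).hom.hom.hom 1 ≫ bettiCohomology.map (π j).hom.hom.hom 1 = 𝟙 _ := by
    have e : ∀ j : Fin h,
        bettiCohomology.map (ι j).hom.hom.hom 1 ≫ bettiCohomology.map (π j).hom.hom.hom 1 =
          bettiCohomology.map (π j ≫ ι j).hom.hom.hom 1 :=
      fun j ↦ (bettiCohomology_map_comp_hom _ _ 1).symm
    rw [Finset.sum_congr rfl fun j _ ↦ e j, ← bettiCohomology_map_sum_one, total]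
    exact bettiCohomology_map_id_hom 1
  refine bijective_sum_comp_proj (fun j ↦ (bettiCohomology.map (π j).hom.hom.hom 1).hom)
    (fun i ↦ (bettiCohomology.map (ι i).hom.hom.hom 1).hom) (fun i j x ↦ ?_) (fun w ↦ ?_)
  · have e := congrArg (fun φ ↦ ModuleCat.Hom.hom φ x) (hιπ i j)
    dsimp only at e
    by_cases hij : i = j
    · rw [if_pos hij] at e ⊢
      exact e
    · rw [if_neg hij] at e ⊢
      exact e
  · have e := congrArg (fun φ ↦ ModuleCat.Hom.hom φ w) hπι
    dsimp only at e
    rw [ModuleCat.hom_sum, LinearMap.sum_apply] at e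
    exact e

/-! ### Type inflation on `H¹` from the printed pieces alone -/

/-- KERNEL: `thm3_inflation_of` with both Betti junction binders discharged — the `H¹`-form of Shimura's type
inflation follows from the open junction hypothesis `Shimura1998_Thm3_isogenousPower` (content of §6.2 Theorem 3
for an induced type) and the printed Corollary `Shimura1998_Thm2_Cor` (§6.1). [folklore] -/
theorem thm3_inflation_of_printed (hd : Shimura1998_Thm3_isogenousPower) (ha : Shimura1998_Thm2_Cor) :
    Shimura1998_Thm3_inflation :=
  thm3_inflation_of hd ha isogeny_bettiMap_bijective_holds product_bettiMap_bijective_holds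

end Literature.AlgebraicGeometry.ComplexMultiplication

end
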